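import Mathlib
import HarnessLib
import Summits.HubbardSuperconductivity.HubbardSuperconductivity.Theorems.KLProgrammeC4aBandDistanceControl
import Summits.HubbardSuperconductivity.HubbardSuperconductivity.Theorems.KLProgrammeC4aTwoNodeCurvatureWindow
import Summits.HubbardSuperconductivity.HubbardSuperconductivity.Theorems.KLProgrammeC4aPartnerBandMixedJetCeiling
import Summits.HubbardSuperconductivity.HubbardSuperconductivity.Theorems.KLProgrammeC4aPartnerBandTangencyDefectThree
import Summits.HubbardSuperconductivity.HubbardSuperconductivity.Theorems.KLProgrammeC4aAbsBubbleNonCooper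

/-!
# Route `KLProgramme` — crux C4a, S3 brick (B4) «(U1)-HYBRID» part D-2a: THE KEY LEMMA NEAR TANGENCY, ONE CALL UNDER `FrameOK` — the first-order anisotropy defect
# `𝒜_φ = ∂_ψ|_θ ē(e,φ;ρ,ϑ,ψ)` is bounded by the three band distances `C₁|ē| + C₂|e| + C₃|ρ|` on the two-node window, with every row discharged from the frame sizes

Cell `gate-hubbard-kl`, seat hubbard-kl-k3c3-p3 (g36; row «implicit-function / monotonicity route for μ(n)»).  Located brick for the (C)-closer lane / the (M4)
assembly of the first-order ϑ-layer (stub (C) `stub_twoLeg_curvature` of `KLRegimeEngineV17F2`, stmt-HubbardSuperconductivity-20437), memo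
HOME/hubbard-kl-k3c3-p3/U1-CAUSTIC-SUP.md §19 «(U1)-HYBRID» (D-2), B4-DIRECT-COUNT.md §1.

WHY.  In the hybrid design the direct sheet's tangency part of the first-order layer (numerator `χ_dir·J·G`) is counted in the CO-MOVING currency: `G = 𝒜_φ − ∂_vē`, the
`∂_vē·(K e)′(ē) = ∂_v[K(ē)]` piece integrates by parts for free, and the KEY LEMMA `|𝒜_φ| ≤ C₁|ē| + C₂|e| + C₃|ρ|` repays the extra inverse power of `(K e)′`, leaving
the `k = 0` envelope count.  `…C4aBandDistanceControl.abs_iteratedDeriv_partnerBand_pp_base_le_band_distance` (p639571) is that lemma BY NAME with its rows as hypotheses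
(curvature floor on the two-node window, mixed-jet ceiling, frame-derivative table `𝒦`, radial rows and their packaging).  This file discharges every row at order `m = 1`:
the floor `2c`, `c = (3/400)u_min²` on `[−W, W] ∋ 0, ϑ, φ` from `partnerBand_pp_level_zero_curvature_floor_window_base` (p640037, `FrameOK`; window condition
`W·(2K₃msD₁³ + 4K₂msD₁msD₂ + K₁msD₃) ≤ (3/200)u_min²`), the ceiling `M = 6·𝒦·D³` from `abs_iteratedDeriv_two_partnerBand_pp_jet_profile_le` (p641303) with
`D := max 1 (max (4·msD₁) (max (6·msD₂) (10·msD₃)))`, `𝒦 := max (max K₀ K₁) (max K₂ K₃)`, the radial rows from `radialRows_le_three` (p629520) packaged as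
`Re = Rp := max (1/d) RR₁`, `De = Dp := max 1 (3msD₁ + r·RR₁)`, `d = Dt_min − 2A`, `RR₁ = radialRowOneConst A d`.
* **`abs_baseDeriv_partnerBand_pp_le_band_distance_frame`** (HEADLINE): under `FrameOK`, for `0 < |ϑ| ≤ W`, `|φ| ≤ W`, `|e| < r`, `|ρ| < r`:
  `|∂_ψ|_θ ē| ≤ (M/2c)·|ē| + (M/2c·𝒦Re + 2𝒦ReDe)·|e| + (M/2c·𝒦Re + 2𝒦ReDe)·|ρ|` with the constants above — `n`-free functions of the frame sizes.
Pure bookkeeping on landed objects; nothing about the model's kernel; nothing asserts (C), K3 or superconductivity.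
References: FST II CPAM 51 (1998) §3 [cite: FeldmanSalmhoferTrubowitz1998]; BGM 2006 §2.4 Lemma 2.1 [cite: BenfattoGiulianiMastropietro2006].
-/

noncomputable section

namespace Summit.HubbardSuperconductivity.HubbardSuperconductivity.Theorems.C4a

set_option linter.dupNamespace false -- summit = problem name (single-conjunct summit), D-0017

open Real Set Filter
open scoped Topology
open Literature.MathematicalPhysics.QuantumLattice Literature.MathematicalPhysics.QuantumLattice.BandSectorCounting Literature.Probability.LatticeModels
open Summit.HubbardSuperconductivity.HubbardSuperconductivity.Theorems.KLRegimeSplit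
open Summit.HubbardSuperconductivity.HubbardSuperconductivity.Theorems.DispersionFlow
open Summit.HubbardSuperconductivity.HubbardSuperconductivity.Theorems.PerturbedFermiCurve

section Sizes

variable {K : TrigPolyC4v} {A : ℝ} (hA : ∀ p : Momentum, ∀ j ≤ 2, ‖iteratedFDeriv ℝ j (frameShift K) p‖ ≤ A) (hA20 : A ≤ 1 / 20)
  (hd : klCurveD ≤ (bandBounds (show (-4 : ℝ) < -1.1 by norm_num) (show (-1.1 : ℝ) ≤ -0.1 by norm_num)
    (show (-0.1 : ℝ) < 0 by norm_num)).Dtmin - 2 * A)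
  {μ r : ℝ} (hr : 0 < r) (hlo : (-1.1 : ℝ) < μ - r - A) (hhi : μ + r + A < -0.1)
  {A₃ A₄ A₅ A₆ : ℝ} (hA₃ : ∀ p : Momentum, ‖iteratedFDeriv ℝ 3 (frameShift K) p‖ ≤ A₃)
  (hA₄ : ∀ p : Momentum, ‖iteratedFDeriv ℝ 4 (frameShift K) p‖ ≤ A₄)
  (hA₅ : ∀ p : Momentum, ‖iteratedFDeriv ℝ 5 (frameShift K) p‖ ≤ A₅)
  (hA₆ : ∀ p : Momentum, ‖iteratedFDeriv ℝ 6 (frameShift K) p‖ ≤ A₆)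
  {K₁ K₂ K₃ : ℝ} (hK₁ : ∀ p : Momentum, ‖fderiv ℝ (frameLevel μ K) p‖ ≤ K₁) (hK₂ : ∀ p : Momentum, ‖iteratedFDeriv ℝ 2 (frameLevel μ K) p‖ ≤ K₂)
  (hK₃ : ∀ p : Momentum, ‖iteratedFDeriv ℝ 3 (frameLevel μ K) p‖ ≤ K₃)
include hA hA20 hd hr hlo hhi hA₃ hA₄ hA₅ hA₆ hK₁ hK₂ hK₃

set_option maxHeartbeats 400000 in
/-- **THE KEY LEMMA NEAR TANGENCY, ONE CALL UNDER `FrameOK`** (HEADLINE; see the module docstring): with `d = Dt_min − 2A`, `RR₁ = radialRowOneConst A d`,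
`𝒦 = max (max K₀ K₁) (max K₂ K₃)`, `D = max 1 (max (4msD₁) (max (6msD₂) (10msD₃)))`, `M = 6𝒦D³`, `c = (3/400)u_min²`, `Re = max (1/d) RR₁`, `De = max 1 (3msD₁ + r·RR₁)`:
on the two-node window `|ϑ| ≤ W`, `ϑ ≠ 0`, `|φ| ≤ W` (window condition `hW`) and for `|e|, |ρ| < r`,
`|∂_ψ|_θ e_K(Φ(0,ψ) + Φ(ρ,ϑ+ψ) − Φ(e,φ+ψ))| ≤ (M/2c)|ē| + (M/2c·𝒦Re + 2·𝒦·Re·De)(|e| + |ρ|)`. -/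
theorem abs_baseDeriv_partnerBand_pp_le_band_distance_frame {R : RenConsts} {U : ℝ} {N : ℕ} (hF : FrameOK R U N μ K) {W K₀ : ℝ}
    (hW : W * (2 * K₃ * msD A₃ A₄ 1 ^ 3 + 4 * K₂ * msD A₃ A₄ 1 * msD A₃ A₄ 2 + K₁ * msD A₃ A₄ 3) ≤
      3 / 200 * (bandBounds (show (-4 : ℝ) < -1.1 by norm_num) (show (-1.1 : ℝ) ≤ -0.1 by norm_num) (show (-0.1 : ℝ) < 0 by norm_num)).umin ^ 2)
    (hK₀ : ∀ p : Momentum, |frameLevel μ K p| ≤ K₀)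
    {ϑ : ℝ} (hϑ0 : ϑ ≠ 0) (hϑW : |ϑ| ≤ W) (θ : ℝ) {ρ e φ : ℝ} (hρ : |ρ| < r) (he : |e| < r) (hφ : |φ| ≤ W) :
    |deriv (fun ψ : ℝ => frameLevel μ K (levelPoint μ K 0 ψ + levelPoint μ K ρ (ϑ + ψ) - levelPoint μ K e (φ + ψ))) θ| ≤
      (6 * (max (max K₀ K₁) (max K₂ K₃)) * (max 1 (max (4 * msD A₃ A₄ 1) (max (6 * msD A₃ A₄ 2) (10 * msD A₃ A₄ 3)))) ^ 3) /
          (2 * (3 / 400 * (bandBounds (show (-4 : ℝ) < -1.1 by norm_num) (show (-1.1 : ℝ) ≤ -0.1 by norm_num) (show (-0.1 : ℝ) < 0 by norm_num)).umin ^ 2)) *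
        |frameLevel μ K (levelPoint μ K 0 θ + levelPoint μ K ρ (ϑ + θ) - levelPoint μ K e (φ + θ))| +
      ((6 * (max (max K₀ K₁) (max K₂ K₃)) * (max 1 (max (4 * msD A₃ A₄ 1) (max (6 * msD A₃ A₄ 2) (10 * msD A₃ A₄ 3)))) ^ 3) /
          (2 * (3 / 400 * (bandBounds (show (-4 : ℝ) < -1.1 by norm_num) (show (-1.1 : ℝ) ≤ -0.1 by norm_num) (show (-0.1 : ℝ) < 0 by norm_num)).umin ^ 2)) *
          ((max (max K₀ K₁) (max K₂ K₃)) *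
            max (1 / ((bandBounds (show (-4 : ℝ) < -1.1 by norm_num) (show (-1.1 : ℝ) ≤ -0.1 by norm_num) (show (-0.1 : ℝ) < 0 by norm_num)).Dtmin - 2 * A))
              (radialRowOneConst A ((bandBounds (show (-4 : ℝ) < -1.1 by norm_num) (show (-1.1 : ℝ) ≤ -0.1 by norm_num) (show (-0.1 : ℝ) < 0 by norm_num)).Dtmin - 2 * A))) +
        (1 + 1 : ℕ).factorial * (max (max K₀ K₁) (max K₂ K₃)) *
          max (1 / ((bandBounds (show (-4 : ℝ) < -1.1 by norm_num) (show (-1.1 : ℝ) ≤ -0.1 by norm_num) (show (-0.1 : ℝ) < 0 by norm_num)).Dtmin - 2 * A))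
            (radialRowOneConst A ((bandBounds (show (-4 : ℝ) < -1.1 by norm_num) (show (-1.1 : ℝ) ≤ -0.1 by norm_num) (show (-0.1 : ℝ) < 0 by norm_num)).Dtmin - 2 * A)) *
          (max 1 (3 * msD A₃ A₄ 1 + r * radialRowOneConst A ((bandBounds (show (-4 : ℝ) < -1.1 by norm_num) (show (-1.1 : ℝ) ≤ -0.1 by norm_num)
            (show (-0.1 : ℝ) < 0 by norm_num)).Dtmin - 2 * A))) ^ 1) * |e| +
      ((6 * (max (max K₀ K₁) (max K₂ K₃)) * (max 1 (max (4 * msD A₃ A₄ 1) (max (6 * msD A₃ A₄ 2) (10 * msD A₃ A₄ 3)))) ^ 3) /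
          (2 * (3 / 400 * (bandBounds (show (-4 : ℝ) < -1.1 by norm_num) (show (-1.1 : ℝ) ≤ -0.1 by norm_num) (show (-0.1 : ℝ) < 0 by norm_num)).umin ^ 2)) *
          ((max (max K₀ K₁) (max K₂ K₃)) *
            max (1 / ((bandBounds (show (-4 : ℝ) < -1.1 by norm_num) (show (-1.1 : ℝ) ≤ -0.1 by norm_num) (show (-0.1 : ℝ) < 0 by norm_num)).Dtmin - 2 * A))
              (radialRowOneConst A ((bandBounds (show (-4 : ℝ) < -1.1 by norm_num) (show (-1.1 : ℝ) ≤ -0.1 by norm_num) (show (-0.1 : ℝ) < 0 by norm_num)).Dtmin - 2 * A))) +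
        (1 + 1 : ℕ).factorial * (max (max K₀ K₁) (max K₂ K₃)) *
          max (1 / ((bandBounds (show (-4 : ℝ) < -1.1 by norm_num) (show (-1.1 : ℝ) ≤ -0.1 by norm_num) (show (-0.1 : ℝ) < 0 by norm_num)).Dtmin - 2 * A))
            (radialRowOneConst A ((bandBounds (show (-4 : ℝ) < -1.1 by norm_num) (show (-1.1 : ℝ) ≤ -0.1 by norm_num) (show (-0.1 : ℝ) < 0 by norm_num)).Dtmin - 2 * A)) *
          (max 1 (3 * msD A₃ A₄ 1 + r * radialRowOneConst A ((bandBounds (show (-4 : ℝ) < -1.1 by norm_num) (show (-1.1 : ℝ) ≤ -0.1 by norm_num)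
            (show (-0.1 : ℝ) < 0 by norm_num)).Dtmin - 2 * A))) ^ 1) * |ρ| := by
  set B := bandBounds (show (-4 : ℝ) < -1.1 by norm_num) (show (-1.1 : ℝ) ≤ -0.1 by norm_num) (show (-0.1 : ℝ) < 0 by norm_num) with hBdef
  have hADt : 2 * A < B.Dtmin := by have := klCurveD_pos; linarith only [this, hd]
  have hDt : 0 < B.Dtmin - 2 * A := by linarith only [hADt]
  have hA0 : 0 ≤ A := le_trans (norm_nonneg _) (hA 0 0 (by norm_num))
  have hu : 0 < B.umin := B.umin_pos
  set d := B.Dtmin - 2 * A with hddef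
  set RR₁ := radialRowOneConst A d with hRR₁
  set 𝒦 : ℝ := max (max K₀ K₁) (max K₂ K₃) with h𝒦
  set D : ℝ := max 1 (max (4 * msD A₃ A₄ 1) (max (6 * msD A₃ A₄ 2) (10 * msD A₃ A₄ 3))) with hDdef
  set Re : ℝ := max (1 / d) RR₁ with hRe
  set De : ℝ := max 1 (3 * msD A₃ A₄ 1 + r * RR₁) with hDe
  set c : ℝ := 3 / 400 * B.umin ^ 2 with hcdef
  have hc0 : 0 < c := by positivity
  have hRR₁0 : 0 ≤ RR₁ := radialRowOneConst_nonneg hA0 hDt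
  have hRe0 : 0 ≤ Re := le_trans (by positivity) (le_max_left _ _)
  have hDe1 : 1 ≤ De := le_max_left _ _
  have hDe0 : 0 ≤ De := zero_le_one.trans hDe1
  have hD1 : 1 ≤ D := le_max_left _ _
  have hD0 : 0 ≤ D := zero_le_one.trans hD1
  -- the frame-derivative table `𝒦`
  have h𝒦K : ∀ i, i ≤ 1 + 2 → ∀ p : Momentum, ‖iteratedFDeriv ℝ i (frameLevel μ K) p‖ ≤ 𝒦 := by
    intro i hi p
    interval_cases i
    · rw [iteratedFDeriv_zero_eq_comp, Function.comp_apply, LinearIsometryEquiv.norm_map, Real.norm_eq_abs]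
      exact (hK₀ p).trans ((le_max_left _ _).trans (le_max_left _ _))
    · rw [← norm_iteratedFDeriv_fderiv, iteratedFDeriv_zero_eq_comp, Function.comp_apply, LinearIsometryEquiv.norm_map]
      exact (hK₁ p).trans ((le_max_right _ _).trans (le_max_left _ _))
    · exact (hK₂ p).trans ((le_max_left _ _).trans (le_max_right _ _))
    · exact (hK₃ p).trans ((le_max_right _ _).trans (le_max_right _ _))
  have h𝒦K' : ∀ i, 1 ≤ i → i ≤ 1 + 1 → ∀ p : Momentum, ‖iteratedFDeriv ℝ i (frameLevel μ K) p‖ ≤ 𝒦 := fun i _ hi p => h𝒦K i (by omega) p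
  -- the window contains both nodes and `φ`
  have hW0 : 0 < W := lt_of_lt_of_le (abs_pos.2 hϑ0) hϑW
  have hab : -W < W := by linarith only [hW0]
  have ha0 : (0 : ℝ) ∈ Icc (-W) W := ⟨by linarith only [hW0], hW0.le⟩
  have hϑab : ϑ ∈ Icc (-W) W := abs_le.1 hϑW
  have hφab : φ ∈ Icc (-W) W := abs_le.1 hφ
  -- the curvature floor on the window (FrameOK)
  have hfloor := partnerBand_pp_level_zero_curvature_floor_window_base hA hA20 hd hr hlo hhi hA₃ hA₄ hK₁ hK₂ hK₃ hF hW hϑW θ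
  -- the mixed-jet ceiling
  have hDrow : ∀ i, 1 ≤ i → i ≤ 1 + 2 → (2 + 2 ^ i) * msD6 A₃ A₄ A₅ A₆ i ≤ D ^ i := by
    intro i hi1 hi3
    have hDi : D ≤ D ^ i := by
      calc D = D ^ 1 := (pow_one D).symm
        _ ≤ D ^ i := pow_le_pow_right₀ hD1 hi1
    interval_cases i
    · rw [msD6_eq_msD _ _ _ _ (by norm_num)]
      have : (2 + 2 ^ 1 : ℝ) * msD A₃ A₄ 1 = 4 * msD A₃ A₄ 1 := by norm_num
      rw [this]; exact le_trans ((le_max_left _ _).trans (le_max_right _ _)) hDi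
    · rw [msD6_eq_msD _ _ _ _ (by norm_num)]
      have : (2 + 2 ^ 2 : ℝ) * msD A₃ A₄ 2 = 6 * msD A₃ A₄ 2 := by norm_num
      rw [this]; exact le_trans (((le_max_left _ _).trans (le_max_right _ _)).trans (le_max_right _ _)) hDi
    · rw [msD6_eq_msD _ _ _ _ (by norm_num)]
      have : (2 + 2 ^ 3 : ℝ) * msD A₃ A₄ 3 = 10 * msD A₃ A₄ 3 := by norm_num
      rw [this]; exact le_trans (((le_max_right _ _).trans (le_max_right _ _)).trans (le_max_right _ _)) hDi
  have hceil : ∀ x ∈ Icc (-W) W, |iteratedDeriv 2 (fun φ : ℝ =>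
      iteratedDeriv 1 (fun ψ : ℝ => frameLevel μ K (levelPoint μ K 0 ψ + levelPoint μ K 0 (ϑ + ψ) - levelPoint μ K 0 (φ + ψ))) θ) x| ≤
      (1 + 2).factorial * 𝒦 * D ^ (1 + 2) :=
    fun x _ => abs_iteratedDeriv_two_partnerBand_pp_jet_profile_le hA hA20 hd hr hlo hhi hA₃ hA₄ hA₅ hA₆ (m := 1) (by norm_num) h𝒦K hDrow ϑ θ x
  -- the radial rows (orders ≤ 3 in the tree; orders ≤ 1 used)
  set RR : ℕ → ℝ := fun i => if i = 0 then 1 / d else if i = 1 then RR₁ else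
      if i = 2 then uRowTwoConst A A₃ d + 1 / d + 2 * (RR₁ - 1 / d) else uRowThreeConst A A₃ A₄ d + 3 * (RR₁ - 1 / d) + 3 * uRowTwoConst A A₃ d + 1 / d with hRRdef
  have hRR0 : RR 0 = 1 / d := by simp [hRRdef]
  have hRR1' : RR 1 = RR₁ := by simp [hRRdef]
  have hrows : ∀ {x : ℝ}, |x| < r → ∀ i, i ≤ 3 → ∀ s, ‖iteratedDeriv i (levelPoint μ K x) s - iteratedDeriv i (levelPoint μ K 0) s‖ ≤ RR i * |x| :=
    fun hx => radialRows_le_three hA hA20 hd hr hlo hhi hA₃ hA₄ (RR := RR) (le_of_eq (by simp [hRRdef, hddef, hBdef])) (le_of_eq (by simp [hRRdef, hRR₁, hddef, hBdef]))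
      (le_of_eq (by simp [hRRdef, hRR₁, hddef, hBdef])) (le_of_eq (by simp [hRRdef, hRR₁, hddef, hBdef])) hx
  have hRRe : ∀ i, i ≤ 1 → ∀ s, ‖iteratedDeriv i (levelPoint μ K e) s - iteratedDeriv i (levelPoint μ K 0) s‖ ≤ RR i * |e| :=
    fun i hi s => hrows he i (by omega) s
  have hRRp : ∀ i, i ≤ 1 → ∀ s, ‖iteratedDeriv i (levelPoint μ K ρ) s - iteratedDeriv i (levelPoint μ K 0) s‖ ≤ RR i * |ρ| :=
    fun i hi s => hrows hρ i (by omega) s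
  have hD10 : 0 ≤ msD A₃ A₄ 1 := (msD_one_pos A₃ A₄).le
  have hDerow : ∀ j, 1 ≤ j → j ≤ 1 → 3 * msD6 A₃ A₄ A₅ A₆ j + |e| * RR j ≤ De ^ j := by
    intro j hj1 hj2
    obtain rfl : j = 1 := le_antisymm hj2 hj1
    rw [pow_one, msD6_eq_msD _ _ _ _ (by norm_num), hRR1']
    have : |e| * RR₁ ≤ r * RR₁ := mul_le_mul_of_nonneg_right he.le hRR₁0
    exact le_trans (by linarith only [this]) (le_max_right _ _)
  have hDprow : ∀ j, 1 ≤ j → j ≤ 1 → 3 * msD6 A₃ A₄ A₅ A₆ j + |ρ| * RR j ≤ De ^ j := by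
    intro j hj1 hj2
    obtain rfl : j = 1 := le_antisymm hj2 hj1
    rw [pow_one, msD6_eq_msD _ _ _ _ (by norm_num), hRR1']
    have : |ρ| * RR₁ ≤ r * RR₁ := mul_le_mul_of_nonneg_right hρ.le hRR₁0
    exact le_trans (by linarith only [this]) (le_max_right _ _)
  have hRerow : ∀ j, j ≤ 1 → RR j ≤ Re * De ^ j := by
    intro j hj
    interval_cases j
    · rw [hRR0, pow_zero, mul_one]; exact le_max_left _ _
    · rw [hRR1', pow_one]
      calc RR₁ ≤ Re := le_max_right _ _
        _ = Re * 1 := (mul_one _).symm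
        _ ≤ Re * De := mul_le_mul_of_nonneg_left hDe1 hRe0
  have hkey := abs_iteratedDeriv_partnerBand_pp_base_le_band_distance hA hA20 hd hr hlo hhi hA₃ hA₄ hA₅ hA₆ (m := 1) (by norm_num) hϑ0 θ hab ha0 hϑab
    hc0 hfloor hceil h𝒦K' hρ he hRRe hRRp hDe0 hRe0 hDe0 hRe0 hDerow hRerow hDprow hRerow hφab
  rw [iteratedDeriv_one] at hkey
  have h6 : ((1 + 2).factorial : ℝ) = 6 := by norm_num [Nat.factorial]
  rw [h6] at hkey
  convert hkey using 2

end Sizes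

end Summit.HubbardSuperconductivity.HubbardSuperconductivity.Theorems.C4a

end
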